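import Summits.HodgeConjecture.HodgeConjecture.Theses.AnchorTransport
import Literature.AlgebraicGeometry.Limits.SmoothProjectiveFamilyModel
import Literature.AlgebraicGeometry.HodgeTheory.InvariantClassesFromTotalSpaceProofs

/-!
# Route AnchorTransport — crux `VariationalHodge` (stmt-HodgeConjecture-1076), line `padic-disc-transport`:
# the SPREADING-OUT OF THE FAMILY for STUB S (`ArithmeticDiscSupply`) — a smooth projective model
# `Y ↪ ℙᴹ_B` of the family over a smooth affine model `Spec B → Spec R` of the base curve

HONEST FRAMING: research route conditional on HC_CM; not a corollary; Q11.4-sentence-2 already refuted in dim ≥ 3.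
Helper file on the crux item (nothing here closes it; no definition, no named fact, no `sorry`;
`HC_CM` does not occur). Cell `pub-hodge-ring2`, binder seat `ring2-b03` (gen 36), BINDER-OWNERS row b03.

STUB S of the registered skeleton `Cruxes/VariationalHodge/Lines/padic_disc_transport.lean` (the
"Maulik–Poonen disc") is built, on the tree's carriers, from: (i) a smooth affine model
`Spec B → Spec R` of the complexified base curve over a finitely generated `ℤ`-algebra `R → ℂ`
together with a smooth projective model `Y ↪ ℙᴹ_B` of the FAMILY — the "spreading out" datum of
Maulik–Poonen 2012, §4; (ii) the `q`-adic residue disc of the anchor on `Spec B`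
(`Theorems.padicDiscSupply`, gen 35, which takes (i) as a hypothesis); (iii) transport. This file proves
(i) for every smooth projective family over a smooth irreducible affine complex curve whose total space is
PROJECTIVE OVER THE BASE (a closed `S`-immersion `𝒳 ↪ S × ℙᴹ`), in particular for quasi-projective
total spaces:

* `padicFamilyModel` — given `f : 𝒳 ⟶ S` smooth projective of relative dimension `n` over `ℂ` with `S`
  affine, irreducible, smooth, one-dimensional, and a closed `S`-immersion `ι : 𝒳 ⟶ S ⊗ ℙᴹ_ℂ`: a ring
  `R` of finite type over `ℤ` with `τ : R →+* ℂ`, an `R`-algebra `B` of finite type with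
  `Spec B → Spec R` smooth of relative dimension `1`, `πS : S → Spec B` cartesian over `Spec τ`, a
  closed subscheme `emb : Y ↪ ℙᴹ_B` with structure morphism `g` proper and smooth of relative
  dimension `n`, and `π𝒳 : 𝒳 → Y` cartesian over `πS` — EXACTLY the model hypotheses of
  `Theorems.padicDiscSupply`;
* `padicFamilyModel_of_isQuasiProjectiveOver` — the same from `HodgeTheory.IsQuasiProjectiveOver 𝒳`
  (a proper morphism from a quasi-projective scheme is projective:
  `HodgeTheory.exists_isClosedImmersion_tensor_projectiveSpace_of_isQuasiProjectiveOver`).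

The mathematics is Literature: `Limits.exists_smooth_projective_family_model_finiteType_int` (EGA IV₃
8.8.2, 8.10.5; IV₄ 17.7.8; Görtz–Wedhorn I Prop. 10.75; Maulik–Poonen 2012 §4, for families).
-/

noncomputable section

-- every declaration of this problem lives in `Summit.HodgeConjecture.HodgeConjecture.…` (summit = sub-problem)
set_option linter.dupNamespace false

open CategoryTheory CategoryTheory.Limits AlgebraicGeometry MonoidalCategory
open Literature.AlgebraicGeometry.Motives Literature.AlgebraicGeometry.HodgeTheory

namespace Summit.HodgeConjecture.HodgeConjecture.Theorems

/-- **The spreading-out datum of STUB S for an `S`-projective family** (Maulik–Poonen 2012, §4, for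
families; EGA IV₃ 8.8.2 (ii), 8.10.5, IV₄ 17.7.8 (ii)). Let `f : 𝒳 ⟶ S` be a smooth projective family
of relative dimension `n` over `ℂ` with `S` affine, irreducible, smooth and one-dimensional, and
`ι : 𝒳 ⟶ S ⊗ ℙᴹ_ℂ` a closed `S`-immersion (`ι ≫ pr₁ = f`). Then there are: a ring `R` of finite type
over `ℤ` with `τ : R →+* ℂ`; an `R`-algebra `B` of finite type with `Spec B → Spec R` smooth of relative
dimension `1`; `πS : S → Spec B` cartesian over `Spec τ`; a closed subscheme `emb : Y ↪ ℙᴹ_B` with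
structure morphism `g = emb ≫ (ℙᴹ_B → Spec B)` proper and smooth of relative dimension `n`; and
`π𝒳 : 𝒳 → Y` with `(π𝒳, f; g, πS)` cartesian — the model hypotheses of `Theorems.padicDiscSupply`,
verbatim. [cite: MaulikPoonen2012, §4] [cite: EGAIV4, Prop. 17.7.8 (ii)] -/
theorem padicFamilyModel {n M : ℕ} {𝒳 S : SchemeOver ℂ} (f : 𝒳 ⟶ S) (hf : IsSmoothProjectiveFamily f n)
    [IrreducibleSpace S.left] [IsAffine S.left] (hsm : AlgebraicGeometry.Smooth S.hom)
    (hdim : topologicalKrullDim S.left = 1)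
    (ι : 𝒳 ⟶ S ⊗ projectiveSpace M ℂ) [IsClosedImmersion ι.left]
    (hι : ι ≫ CartesianMonoidalCategory.fst S (projectiveSpace M ℂ) = f) :
    ∃ (R B : Type) (_ : CommRing R) (_ : CommRing B) (_ : Algebra R B) (_ : Algebra.FiniteType ℤ R)
      (_ : Algebra.FiniteType R B)
      (_ : SmoothOfRelativeDimension 1 (Spec.map (CommRingCat.ofHom (algebraMap R B))))
      (τ : R →+* ℂ) (πS : S.left ⟶ Spec (.of B))
      (_ : IsPullback πS S.hom (Spec.map (CommRingCat.ofHom (algebraMap R B)))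
        (Spec.map (CommRingCat.ofHom τ)))
      (Y : Scheme.{0}) (g : Y ⟶ Spec (.of B))
      (emb : letI := MvPolynomial.gradedAlgebra (σ := Fin (M + 1)) (R := B)
        Y ⟶ Proj (MvPolynomial.homogeneousSubmodule (Fin (M + 1)) B))
      (_ : IsClosedImmersion emb)
      (_ : letI := MvPolynomial.gradedAlgebra (σ := Fin (M + 1)) (R := B)
        emb ≫ ProjBaseChangeRing.projToSpec (Fin (M + 1)) B = g)
      (π𝒳 : 𝒳.left ⟶ Y),
      IsProper g ∧ SmoothOfRelativeDimension n g ∧ IsPullback π𝒳 f.left g πS := by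
  classical
  haveI : Smooth S.hom := hsm
  -- the base is an integral affine curve, smooth of relative dimension `1`
  obtain ⟨d, hd⟩ := exists_smoothOfRelativeDimension_of_smooth S.hom
  haveI := hd
  haveI : IsReduced S.left := isReduced_of_smoothOfRelativeDimension S.hom d
  haveI : IsIntegral S.left := isIntegral_of_irreducibleSpace_of_isReduced _
  have hd1 : d = 1 := by
    have h := topologicalKrullDim_eq_of_smoothOfRelativeDimension S.hom d
    rw [hdim] at h
    exact_mod_cast h.symm
  subst hd1
  haveI := hf.smoothOfRelativeDimension
  obtain ⟨R, _, _, _, B, _, _, _, πS, Y, g, emb, _, hembg, π𝒳, hBd, hπS, hgP, hgn, h𝒳⟩ :=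
    Literature.AlgebraicGeometry.Limits.exists_smooth_projective_family_model_finiteType_int
      (d := 1) (n := n) S f ι hι
  exact ⟨R, B, inferInstance, inferInstance, inferInstance, inferInstance, inferInstance, hBd,
    algebraMap R ℂ, πS, hπS, Y, g, emb, inferInstance, hembg, π𝒳, hgP, hgn, h𝒳⟩

/-- **The spreading-out datum of STUB S for a family with QUASI-PROJECTIVE total space** (the
carriers of `Ring2.Hypotheses.VariationalHodgeQP`): for `f : 𝒳 ⟶ S` smooth projective of relative
dimension `n` over `ℂ` with `S` affine, irreducible, smooth, one-dimensional and `𝒳` quasi-projective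
over `ℂ`, the proper `f` is projective — a closed `S`-immersion `𝒳 ↪ S ⊗ ℙᴹ_ℂ`
(`HodgeTheory.exists_isClosedImmersion_tensor_projectiveSpace_of_isQuasiProjectiveOver`, Hartshorne II
Cor. 4.8 (e)) — and `padicFamilyModel` supplies the model hypotheses of `Theorems.padicDiscSupply`.
[cite: MaulikPoonen2012, §4] [cite: Hartshorne1977, Ch. II Cor. 4.8 (e)] -/
theorem padicFamilyModel_of_isQuasiProjectiveOver {n : ℕ} {𝒳 S : SchemeOver ℂ} (f : 𝒳 ⟶ S)
    (hf : IsSmoothProjectiveFamily f n)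
    [IrreducibleSpace S.left] [IsAffine S.left] (hsm : AlgebraicGeometry.Smooth S.hom)
    (hdim : topologicalKrullDim S.left = 1) (h𝒳 : IsQuasiProjectiveOver 𝒳) :
    ∃ (M : ℕ) (R B : Type) (_ : CommRing R) (_ : CommRing B) (_ : Algebra R B)
      (_ : Algebra.FiniteType ℤ R) (_ : Algebra.FiniteType R B)
      (_ : SmoothOfRelativeDimension 1 (Spec.map (CommRingCat.ofHom (algebraMap R B))))
      (τ : R →+* ℂ) (πS : S.left ⟶ Spec (.of B))
      (_ : IsPullback πS S.hom (Spec.map (CommRingCat.ofHom (algebraMap R B)))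
        (Spec.map (CommRingCat.ofHom τ)))
      (Y : Scheme.{0}) (g : Y ⟶ Spec (.of B))
      (emb : letI := MvPolynomial.gradedAlgebra (σ := Fin (M + 1)) (R := B)
        Y ⟶ Proj (MvPolynomial.homogeneousSubmodule (Fin (M + 1)) B))
      (_ : IsClosedImmersion emb)
      (_ : letI := MvPolynomial.gradedAlgebra (σ := Fin (M + 1)) (R := B)
        emb ≫ ProjBaseChangeRing.projToSpec (Fin (M + 1)) B = g)
      (π𝒳 : 𝒳.left ⟶ Y),
      IsProper g ∧ SmoothOfRelativeDimension n g ∧ IsPullback π𝒳 f.left g πS := by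
  haveI := hf.isProper
  haveI : IsSeparated S.hom := inferInstance
  obtain ⟨M, ι, hι, hιf⟩ := exists_isClosedImmersion_tensor_projectiveSpace_of_isQuasiProjectiveOver f h𝒳
  haveI := hι
  obtain ⟨R, B, _, _, _, _, _, hBd, τ, πS, hπS, Y, g, emb, _, hembg, π𝒳, hgP, hgn, h𝒳⟩ :=
    padicFamilyModel f hf hsm hdim ι hιf
  exact ⟨M, R, B, inferInstance, inferInstance, inferInstance, inferInstance, inferInstance, hBd, τ, πS,
    hπS, Y, g, emb, inferInstance, hembg, π𝒳, hgP, hgn, h𝒳⟩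

end Summit.HodgeConjecture.HodgeConjecture.Theorems

end
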